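import Summits.ResolutionOfSingularities.ResolutionOfSingularities.Theorems.FrobeniusLadderFRationalResolutionGaloisTwistChart
import Mathlib.RingTheory.Flat.FaithfullyFlat.Algebra
import Mathlib.RingTheory.Flat.Localization
import Mathlib.RingTheory.Localization.AtPrime.Basic
import Mathlib.RingTheory.Localization.Away.Basic
import Mathlib.RingTheory.Localization.Ideal
import HarnessLib

/-!
# Crux `FrobeniusLadder.FRationalResolution` (stmt-ResolutionOfSingularities-15317), line `redirect`,
# stub `stub_diagonalizableQuotientResolution` — twists in the STABILIZER OF THE CHART POINT fix the upstairs piece: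
# `σ''(𝔚) = 𝔚 ⇒ (1 ⊗ σ) I₁ = I₁`

The upstairs piece `I₁ ⊆ B' = B ⊗_K K'` of the Galois route (`…GaloisUpstairsPieceCover.exists_piece_cover`, ✓p835702) is descended from
the chart centre `J` at a trivial-residue point `𝔚` of the chart `C' = B' ⊗_B C`: `I₁ C'_G = J C'_G` for some `G ∉ 𝔚`, and
`I₁ ⊇ 𝔔'ⁿ`. The remaining obligation concerns the twists `(1 ⊗ σ) I₁`, `σ` in the decomposition group `D` of `𝔔'`. THIS FILE:
if the chart twist `σ'' = (1 ⊗ σ) ⊗ 1` (`…GaloisTwistChart`, ✓p835739) FIXES the point `𝔚`, then `(1 ⊗ σ) I₁ = I₁` on the nose.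
So decomposition-stability `hD` of `I₁` holds on the stabilizer `D_𝔚 ⊆ D` for free, the symmetrization `∏_{σ ∈ D} (1 ⊗ σ) I₁`
(✓p835018) only involves `D / D_𝔚`, and when `D_𝔚 = D` — e.g. when the residue extension `κ(𝔔)/κ(𝔭)` of the chart point admits only
ONE `κ(𝔭)`-embedding into `κ(𝔔')` (purely inseparable residue extensions!) — the piece `I₁` itself is decomposition-stable and
`…GaloisOrbitAssembly.hloc_of_decomposition_stable_piece'` closes the point with no twist obligation at all: the genuinely twisted
case comes from the SEPARABLE part of `κ(𝔔)/κ(𝔭)` only (memo MEMO-15317-leafhand2-g14).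

Proof: `(1 ⊗ σ) I₁ · C' = σ''(I₁ C')` (TwistChart); transporting `I₁ C'_G = J C'_G` along `σ''` (which fixes `J C'`) gives
`σ''(I₁ C') · C'_{G σ''G} = J · C'_{G σ''G} = I₁ · C'_{G σ''G}`; both `G, σ''G ∉ 𝔚 = σ''𝔚`, so `C'_{G σ''G}` is a flat `B'`-algebra with a
point over `𝔔'`, and two ideals containing `𝔔'ⁿ` with the same extension to such an algebra are equal (faithfully flat descent
along `B'_{𝔔'} → (C'_{G σ''G})_𝔚`, Mathlib `Ideal.comap_map_eq_self_of_faithfullyFlat`).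

* `le_of_map_le_of_flat_of_pow_le`, `eq_of_map_eq_of_flat_of_pow_le` — descent of (in)equalities of `𝔮`-coprimary ideals along a
  flat algebra with a prime over the maximal ideal `𝔮`.
* **`map_twist_eq_self_of_map_chartTwist_eq`** — the statement in the title.

Honest label: plumbing/structure toward ONE leaf stub (no stub, crux or summit closed). No definitions, no named facts, no sorry.
[cite: StacksProject, Tag 09EB; Tag 00HP] 
-/

noncomputable section

-- single-problem summit: the doubled namespace component is forced
set_option linter.dupNamespace false

open scoped TensorProduct

namespace Summit.ResolutionOfSingularities.ResolutionOfSingularities.Theorems.FRationalResolution.GaloisTwistStabilizer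

/-! ### Descent of coprimary ideals along a flat algebra with a point over the maximal ideal -/

/-- **Descent of an inclusion.** `T` a flat `A`-algebra with a prime `P` over the maximal ideal `𝔮`, `𝔟 ⊇ 𝔮ⁿ`: if `𝔞 T ⊆ 𝔟 T`
then `𝔞 ⊆ 𝔟`. (`A_𝔮 → T_P` is local and flat, hence faithfully flat; contract.) [cite: StacksProject, Tag 00HP] -/
theorem le_of_map_le_of_flat_of_pow_le {A T : Type*} [CommRing A] [CommRing T] [Algebra A T] [Module.Flat A T]
    (𝔮 : Ideal A) [h𝔮 : 𝔮.IsMaximal] (P : Ideal T) [P.IsPrime] (hP : P.comap (algebraMap A T) = 𝔮)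
    (𝔞 𝔟 : Ideal A) {n : ℕ} (h𝔟 : 𝔮 ^ n ≤ 𝔟)
    (hle : 𝔞.map (algebraMap A T) ≤ 𝔟.map (algebraMap A T)) : 𝔞 ≤ 𝔟 := by
  haveI : P.LiesOver 𝔮 := ⟨hP.symm⟩
  letI := Localization.AtPrime.algebraOfLiesOver 𝔮 P
  set Aq := Localization.AtPrime 𝔮 with hAq
  set TP := Localization.AtPrime P with hTP
  haveI : IsLocalHom (algebraMap Aq TP) := by
    rw [Localization.AtPrime.IsLiesOverAlgebra.algebraMap_eq (p := 𝔮) (P := P)]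
    exact Localization.isLocalHom_localRingHom 𝔮 P (algebraMap A T) _
  haveI : Module.FaithfullyFlat Aq TP := Module.FaithfullyFlat.of_flat_of_isLocalHom
  -- extend to `A_𝔮`, compare in `T_P`
  have h1 : (𝔞.map (algebraMap A Aq)).map (algebraMap Aq TP) ≤ (𝔟.map (algebraMap A Aq)).map (algebraMap Aq TP) := by
    rw [Ideal.map_map, Ideal.map_map, ← IsScalarTower.algebraMap_eq A Aq TP, IsScalarTower.algebraMap_eq A T TP,
      ← Ideal.map_map, ← Ideal.map_map]
    exact Ideal.map_mono hle
  have h2 : 𝔞.map (algebraMap A Aq) ≤ 𝔟.map (algebraMap A Aq) := by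
    have h := Ideal.comap_mono (f := algebraMap Aq TP) h1
    rwa [Ideal.comap_map_eq_self_of_faithfullyFlat, Ideal.comap_map_eq_self_of_faithfullyFlat] at h
  -- contract to `A`: `x ∈ 𝔞 ⇒ m x ∈ 𝔟` for some `m ∉ 𝔮`, and `(m) + 𝔮ⁿ = A`
  intro x hx
  have hx' : algebraMap A Aq x ∈ 𝔟.map (algebraMap A Aq) := h2 (Ideal.mem_map_of_mem _ hx)
  obtain ⟨m, hm, hmx⟩ := (IsLocalization.algebraMap_mem_map_algebraMap_iff 𝔮.primeCompl Aq 𝔟 x).mp hx'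
  have hm𝔮 : m ∉ 𝔮 := hm
  have hsup : Ideal.span {m} ⊔ 𝔮 = ⊤ := by
    refine h𝔮.out.2 _ (lt_of_le_of_ne le_sup_right fun h => hm𝔮 ?_)
    rw [h]
    exact Ideal.mem_sup_left (Ideal.mem_span_singleton_self m)
  have htop : Ideal.span {m} ⊔ 𝔮 ^ n = ⊤ := Ideal.sup_pow_eq_top hsup
  have h1mem : (1 : A) ∈ Ideal.span {m} ⊔ 𝔮 ^ n := htop ▸ Submodule.mem_top
  obtain ⟨u, hu, t, ht, hut⟩ := Submodule.mem_sup.mp h1mem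
  obtain ⟨r, rfl⟩ := Ideal.mem_span_singleton'.mp hu
  have hx1 : x = r * (m * x) + x * t := by
    calc x = x * (r * m + t) := by rw [hut, mul_one]
      _ = r * (m * x) + x * t := by ring
  rw [hx1]
  exact 𝔟.add_mem (𝔟.mul_mem_left r hmx) (𝔟.mul_mem_left x (h𝔟 ht))

/-- **Descent of an equality.** `T` a flat `A`-algebra with a prime over the maximal ideal `𝔮`, `𝔞, 𝔟 ⊇ 𝔮ⁿ`: `𝔞 T = 𝔟 T ⇒ 𝔞 = 𝔟`.
[cite: StacksProject, Tag 00HP] -/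
theorem eq_of_map_eq_of_flat_of_pow_le {A T : Type*} [CommRing A] [CommRing T] [Algebra A T] [Module.Flat A T]
    (𝔮 : Ideal A) [𝔮.IsMaximal] (P : Ideal T) [P.IsPrime] (hP : P.comap (algebraMap A T) = 𝔮)
    (𝔞 𝔟 : Ideal A) {n : ℕ} (h𝔞 : 𝔮 ^ n ≤ 𝔞) (h𝔟 : 𝔮 ^ n ≤ 𝔟)
    (heq : 𝔞.map (algebraMap A T) = 𝔟.map (algebraMap A T)) : 𝔞 = 𝔟 :=
  le_antisymm (le_of_map_le_of_flat_of_pow_le 𝔮 P hP 𝔞 𝔟 h𝔟 heq.le)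
    (le_of_map_le_of_flat_of_pow_le 𝔮 P hP 𝔟 𝔞 h𝔞 heq.ge)

/-! ### Twists fixing the chart point fix the piece -/

set_option maxHeartbeats 1600000 in
/-- **`σ''(𝔚) = 𝔚 ⇒ (1 ⊗ σ) I₁ = I₁`.** Data: `B' = B ⊗_K K'`, `C` a flat `B`-algebra, `C' = B' ⊗_B C`; `𝔔' ⊆ B'` maximal,
`I₁ ⊇ 𝔔'ⁿ`; a prime `𝔚 ⊆ C'` over `𝔔'`; `G ∉ 𝔚` with `I₁ C'_G = J C'_G` for an ideal `J ⊆ C` (the output of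
`…GaloisUpstairsPieceCover.exists_piece_cover`); and `σ ∈ Aut_K(K')` whose chart twist fixes `𝔚`. [cite: StacksProject, Tag 09EB; Tag 00HP] -/
theorem map_twist_eq_self_of_map_chartTwist_eq {K B K' C : Type} [Field K] [CommRing B] [Algebra K B] [Field K']
    [Algebra K K'] [CommRing C] [Algebra B C] [Module.Flat B C]
    (𝔔' : Ideal (B ⊗[K] K')) [𝔔'.IsMaximal] (I₁ : Ideal (B ⊗[K] K')) {n : ℕ} (hn : 𝔔' ^ n ≤ I₁) (J : Ideal C)
    (𝔚 : Ideal ((B ⊗[K] K') ⊗[B] C)) [h𝔚 : 𝔚.IsPrime]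
    (h𝔚B : 𝔚.comap (algebraMap (B ⊗[K] K') ((B ⊗[K] K') ⊗[B] C)) = 𝔔')
    (G : (B ⊗[K] K') ⊗[B] C) (hG : G ∉ 𝔚)
    (hIJ : I₁.map (algebraMap (B ⊗[K] K') (Localization.Away G)) =
      (J.map ((Algebra.TensorProduct.includeRight : C →ₐ[B] (B ⊗[K] K') ⊗[B] C) : C →+* (B ⊗[K] K') ⊗[B] C)).map
        (algebraMap ((B ⊗[K] K') ⊗[B] C) (Localization.Away G)))
    (σ : K' ≃ₐ[K] K')
    (hσ𝔚 : 𝔚.map (Algebra.TensorProduct.map (Algebra.TensorProduct.map (AlgHom.id B B) (σ : K' →ₐ[K] K'))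
      (AlgHom.id B C)) = 𝔚) :
    I₁.map (Algebra.TensorProduct.map (AlgHom.id B B) (σ : K' →ₐ[K] K')) = I₁ := by
  -- opaque names for the twists and the structure maps (keeps definitional unfolding cheap)
  obtain ⟨tw, htw⟩ : ∃ tw : B ⊗[K] K' →ₐ[B] B ⊗[K] K',
      tw = Algebra.TensorProduct.map (AlgHom.id B B) (σ : K' →ₐ[K] K') := ⟨_, rfl⟩
  obtain ⟨Tw, hTw⟩ : ∃ Tw : (B ⊗[K] K') ⊗[B] C →ₐ[B] (B ⊗[K] K') ⊗[B] C,
      Tw = Algebra.TensorProduct.map (Algebra.TensorProduct.map (AlgHom.id B B) (σ : K' →ₐ[K] K')) (AlgHom.id B C) :=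
    ⟨_, rfl⟩
  obtain ⟨iR, hiR⟩ : ∃ iR : C →+* (B ⊗[K] K') ⊗[B] C,
      iR = ((Algebra.TensorProduct.includeRight : C →ₐ[B] (B ⊗[K] K') ⊗[B] C) : C →+* (B ⊗[K] K') ⊗[B] C) :=
    ⟨_, rfl⟩
  rw [← htw]
  rw [← hTw] at hσ𝔚
  rw [← hiR] at hIJ
  set iB : B ⊗[K] K' →+* (B ⊗[K] K') ⊗[B] C := algebraMap (B ⊗[K] K') ((B ⊗[K] K') ⊗[B] C) with hiB
  -- the chart-twist identities (from `…GaloisTwistChart`), in the opaque names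
  have hσ : 𝔔'.map tw = 𝔔' := by
    have h := GaloisTwistChart.comap_algebraMap_map_chartTwist (B := B) (C := C) σ 𝔚
    rw [← hTw, ← htw, hσ𝔚, ← hiB, h𝔚B] at h
    exact h.symm
  have hA : (I₁.map iB).map (Tw : (B ⊗[K] K') ⊗[B] C →+* (B ⊗[K] K') ⊗[B] C) = (I₁.map tw).map iB := by
    have h := GaloisTwistChart.map_chartTwist_map_algebraMap (B := B) (C := C) σ I₁
    rw [← hTw, ← htw, ← hiB] at h
    exact h
  have hB : (J.map iR).map (Tw : (B ⊗[K] K') ⊗[B] C →+* (B ⊗[K] K') ⊗[B] C) = J.map iR := by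
    have h := GaloisTwistChart.map_chartTwist_map_includeRight (B := B) (K := K) (K' := K') (C := C) σ J
    rw [← hTw, ← hiR] at h
    exact h
  have hTwinv : ∀ x, Algebra.TensorProduct.map
      (Algebra.TensorProduct.map (AlgHom.id B B) ((σ⁻¹ : K' ≃ₐ[K] K') : K' →ₐ[K] K')) (AlgHom.id B C) (Tw x) = x := by
    intro x
    rw [hTw]
    exact GaloisTwistChart.chartTwist_inv_apply (B := B) (C := C) σ x
  have hTwG : Tw G ∉ 𝔚 := by
    intro hmem
    apply hG
    have h2 : Tw G ∈ 𝔚.map Tw := by rw [hσ𝔚]; exact hmem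
    rw [hTw, ← GaloisTwistChart.comap_chartTwist_inv_eq_map, Ideal.mem_comap, ← hTw, hTwinv] at h2
    exact h2
  -- the localization `T = C'_{G σ''G}` and its point over `𝔔'`
  have hdisj : Disjoint ((Submonoid.powers (G * Tw G) : Submonoid ((B ⊗[K] K') ⊗[B] C)) : Set ((B ⊗[K] K') ⊗[B] C))
      (𝔚 : Set ((B ⊗[K] K') ⊗[B] C)) := by
    refine Set.disjoint_left.mpr ?_
    rintro x ⟨m, rfl⟩ hx
    have hx' : G ^ m * Tw G ^ m ∈ 𝔚 := by rw [← mul_pow]; exact hx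
    rcases h𝔚.mem_or_mem hx' with h | h
    · exact hG (h𝔚.mem_of_pow_mem m h)
    · exact hTwG (h𝔚.mem_of_pow_mem m h)
  set P : Ideal (Localization.Away (algebraMap ((B ⊗[K] K') ⊗[B] C) (Localization.Away G) (Tw G))) := 𝔚.map (algebraMap ((B ⊗[K] K') ⊗[B] C) (Localization.Away (algebraMap ((B ⊗[K] K') ⊗[B] C) (Localization.Away G) (Tw G)))) with hPdef
  haveI hPprime : P.IsPrime :=
    IsLocalization.isPrime_of_isPrime_disjoint (Submonoid.powers (G * Tw G)) (Localization.Away (algebraMap ((B ⊗[K] K') ⊗[B] C) (Localization.Away G) (Tw G))) 𝔚 h𝔚 hdisj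
  have hPc : P.comap (algebraMap ((B ⊗[K] K') ⊗[B] C) (Localization.Away (algebraMap ((B ⊗[K] K') ⊗[B] C) (Localization.Away G) (Tw G)))) = 𝔚 :=
    IsLocalization.under_map_of_isPrime_disjoint (Submonoid.powers (G * Tw G)) (Localization.Away (algebraMap ((B ⊗[K] K') ⊗[B] C) (Localization.Away G) (Tw G))) h𝔚 hdisj
  have hPB : P.comap (algebraMap (B ⊗[K] K') (Localization.Away (algebraMap ((B ⊗[K] K') ⊗[B] C) (Localization.Away G) (Tw G)))) = 𝔔' := by
    rw [IsScalarTower.algebraMap_eq (B ⊗[K] K') ((B ⊗[K] K') ⊗[B] C) (Localization.Away (algebraMap ((B ⊗[K] K') ⊗[B] C) (Localization.Away G) (Tw G))), ← Ideal.comap_comap, hPc, ← hiB, h𝔚B]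
  -- (i) `I₁ C'_G = J C'_G`, read in `C'` then `L = C'_G`, and pushed to `T`
  have hI₁L : (I₁.map iB).map (algebraMap ((B ⊗[K] K') ⊗[B] C) (Localization.Away G)) =
      (J.map iR).map (algebraMap ((B ⊗[K] K') ⊗[B] C) (Localization.Away G)) := by
    rw [hiB, Ideal.map_map, ← IsScalarTower.algebraMap_eq (B ⊗[K] K') ((B ⊗[K] K') ⊗[B] C) (Localization.Away G)]
    exact hIJ
  have hI₁T : I₁.map (algebraMap (B ⊗[K] K') (Localization.Away (algebraMap ((B ⊗[K] K') ⊗[B] C) (Localization.Away G) (Tw G)))) = (J.map iR).map (algebraMap ((B ⊗[K] K') ⊗[B] C) (Localization.Away (algebraMap ((B ⊗[K] K') ⊗[B] C) (Localization.Away G) (Tw G)))) := by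
    rw [IsScalarTower.algebraMap_eq (B ⊗[K] K') (Localization.Away G) (Localization.Away (algebraMap ((B ⊗[K] K') ⊗[B] C) (Localization.Away G) (Tw G))), ← Ideal.map_map, hIJ, Ideal.map_map,
      ← IsScalarTower.algebraMap_eq ((B ⊗[K] K') ⊗[B] C) (Localization.Away G) (Localization.Away (algebraMap ((B ⊗[K] K') ⊗[B] C) (Localization.Away G) (Tw G)))]
  -- (ii) `((1 ⊗ σ) I₁) T = σ''(I₁ C') T = J T`, transporting (i) along `σ''`
  have hunit : IsUnit (((algebraMap ((B ⊗[K] K') ⊗[B] C) (Localization.Away (algebraMap ((B ⊗[K] K') ⊗[B] C) (Localization.Away G) (Tw G)))).comp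
      (Tw : (B ⊗[K] K') ⊗[B] C →+* (B ⊗[K] K') ⊗[B] C)) G) := by
    rw [RingHom.comp_apply, IsScalarTower.algebraMap_apply ((B ⊗[K] K') ⊗[B] C) (Localization.Away G) (Localization.Away (algebraMap ((B ⊗[K] K') ⊗[B] C) (Localization.Away G) (Tw G)))]
    exact IsLocalization.Away.algebraMap_isUnit (algebraMap ((B ⊗[K] K') ⊗[B] C) (Localization.Away G) (Tw G))
  obtain ⟨μ, hμc⟩ : ∃ μ : (Localization.Away G) →+* (Localization.Away (algebraMap ((B ⊗[K] K') ⊗[B] C) (Localization.Away G) (Tw G))), μ.comp (algebraMap ((B ⊗[K] K') ⊗[B] C) (Localization.Away G)) =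
      (algebraMap ((B ⊗[K] K') ⊗[B] C) (Localization.Away (algebraMap ((B ⊗[K] K') ⊗[B] C) (Localization.Away G) (Tw G)))).comp (Tw : (B ⊗[K] K') ⊗[B] C →+* (B ⊗[K] K') ⊗[B] C) :=
    ⟨IsLocalization.Away.lift G hunit, IsLocalization.Away.lift_comp G hunit⟩
  have h1 : (I₁.map tw).map (algebraMap (B ⊗[K] K') (Localization.Away (algebraMap ((B ⊗[K] K') ⊗[B] C) (Localization.Away G) (Tw G)))) =
      ((I₁.map tw).map iB).map (algebraMap ((B ⊗[K] K') ⊗[B] C) (Localization.Away (algebraMap ((B ⊗[K] K') ⊗[B] C) (Localization.Away G) (Tw G)))) := by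
    rw [hiB, Ideal.map_map, ← IsScalarTower.algebraMap_eq (B ⊗[K] K') ((B ⊗[K] K') ⊗[B] C) (Localization.Away (algebraMap ((B ⊗[K] K') ⊗[B] C) (Localization.Away G) (Tw G)))]
  have h2 : ((I₁.map iB).map (Tw : (B ⊗[K] K') ⊗[B] C →+* (B ⊗[K] K') ⊗[B] C)).map
      (algebraMap ((B ⊗[K] K') ⊗[B] C) (Localization.Away (algebraMap ((B ⊗[K] K') ⊗[B] C) (Localization.Away G) (Tw G)))) = ((I₁.map iB).map (algebraMap ((B ⊗[K] K') ⊗[B] C) (Localization.Away G))).map μ := by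
    rw [Ideal.map_map (Tw : (B ⊗[K] K') ⊗[B] C →+* (B ⊗[K] K') ⊗[B] C) (algebraMap ((B ⊗[K] K') ⊗[B] C) (Localization.Away (algebraMap ((B ⊗[K] K') ⊗[B] C) (Localization.Away G) (Tw G)))),
      Ideal.map_map (algebraMap ((B ⊗[K] K') ⊗[B] C) (Localization.Away G)) μ, hμc]
  have h3 : ((J.map iR).map (algebraMap ((B ⊗[K] K') ⊗[B] C) (Localization.Away G))).map μ =
      ((J.map iR).map (Tw : (B ⊗[K] K') ⊗[B] C →+* (B ⊗[K] K') ⊗[B] C)).map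
        (algebraMap ((B ⊗[K] K') ⊗[B] C) (Localization.Away (algebraMap ((B ⊗[K] K') ⊗[B] C) (Localization.Away G) (Tw G)))) := by
    rw [Ideal.map_map (Tw : (B ⊗[K] K') ⊗[B] C →+* (B ⊗[K] K') ⊗[B] C) (algebraMap ((B ⊗[K] K') ⊗[B] C) (Localization.Away (algebraMap ((B ⊗[K] K') ⊗[B] C) (Localization.Away G) (Tw G)))),
      Ideal.map_map (algebraMap ((B ⊗[K] K') ⊗[B] C) (Localization.Away G)) μ, hμc]
  have htwT : (I₁.map tw).map (algebraMap (B ⊗[K] K') (Localization.Away (algebraMap ((B ⊗[K] K') ⊗[B] C) (Localization.Away G) (Tw G)))) = (J.map iR).map (algebraMap ((B ⊗[K] K') ⊗[B] C) (Localization.Away (algebraMap ((B ⊗[K] K') ⊗[B] C) (Localization.Away G) (Tw G)))) :=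
    h1.trans <| ((congrArg (Ideal.map (algebraMap ((B ⊗[K] K') ⊗[B] C) (Localization.Away (algebraMap ((B ⊗[K] K') ⊗[B] C) (Localization.Away G) (Tw G))))) hA).symm.trans <| h2.trans <|
      (congrArg (Ideal.map μ) hI₁L).trans <| h3.trans <| congrArg (Ideal.map (algebraMap ((B ⊗[K] K') ⊗[B] C) (Localization.Away (algebraMap ((B ⊗[K] K') ⊗[B] C) (Localization.Away G) (Tw G))))) hB)
  -- (iii) descend
  have hntw : 𝔔' ^ n ≤ I₁.map tw := by
    calc 𝔔' ^ n = (𝔔'.map tw) ^ n := by rw [hσ]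
      _ = (𝔔' ^ n).map tw := (Ideal.map_pow tw 𝔔' n).symm
      _ ≤ I₁.map tw := Ideal.map_mono hn
  exact eq_of_map_eq_of_flat_of_pow_le 𝔔' P hPB (I₁.map tw) I₁ hntw hn (htwT.trans hI₁T.symm)

end Summit.ResolutionOfSingularities.ResolutionOfSingularities.Theorems.FRationalResolution.GaloisTwistStabilizer

end
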